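import Mathlib
import Summits.KontsevichZagierPeriods.KontsevichZagierPeriods.Theorems.InverseLandauTateLiftingGenusZeroSector
import Summits.KontsevichZagierPeriods.KontsevichZagierPeriods.Theorems.InverseLandauTateLiftingBandArea

/-!
# `TateLifting` (stmt-KontsevichZagierPeriods-9129), line `Sketch` — the genus-zero sector: pair forms, conic bands

Sequel to `Theorems/InverseLandauTateLiftingGenusZeroSector.lean` (continuation lead c7): the crux on the
genus-zero sector (`TateLifting_genusZeroSector`), the two-representation forms of `genusZeroLowDimKernel`
(`kzPeriodConjecture_conic`, `_conic_conic`, `_root`), and AREAS: the area representation `[B, 1]` of a CONIC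
BAND `B = {(x, y) | x ∈ τ, α(x) ≤ y ≤ β(x)}` between two arcs `α = A(x, √q(x)) ≤ β = B(x, √q(x))`
(`A, B ∈ K(X, Y)`, `K = ℚ̄ ∩ ℝ`, `q = ax² + bx + c > 0` on the `ℚ`-semialgebraic base `τ ⊆ ℝ`) differs by ONE
Newton–Leibniz move with the primitive `y` (`tateLifting_bandArea`: `[B, 1] ≡ [τ, β − α]`, the integrability of
`β − α` being the finiteness of the area) from a conic representation (`GenusZero.conicBand_reduce`), whence
`conicBandKernel` (Conjecture 1 on genus-zero one-forms + conic bands) and `kzPeriodConjecture_conicBand`: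
**two conic bands over `ℚ̄ ∩ ℝ` with the same area are KZ-equivalent** — scissors congruence for degree-two
plane regions (circular / elliptic / parabolic / hyperbolic segments, triangles, trapezoids with algebraic
vertices; e.g. Archimedes' quadrature of the parabola) inside the Kontsevich–Zagier calculus.

References: M. Kontsevich, D. Zagier, *Periods* (2001), §1.2 (Conjecture 1, rules (1)–(3)); A. Baker,
*Transcendental Number Theory* (1975), Thm 2.1 (through `kzKernelConjecture_lowDimAlg`).
-/

noncomputable section

open MeasureTheory Set
open Literature.NumberTheory.Transcendental
open Literature.ModelTheory.ExponentialFields (IsSemialgebraic)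

namespace Summit.KontsevichZagierPeriods.InverseLandau

/-- **The crux on the genus-zero sector**: every such vanishing combination lies in
`KZ.relations ⊔ closure T` for the Tate set `T` of `TateLifting` (indeed in `KZ.relations`).
[cite: KontsevichZagier2001, §1.2] -/
theorem TateLifting_genusZeroSector :
    ∀ c ∈ AddSubgroup.closure
        ({d : KZ.FormalRep | (∃ r : KZ.IntegralRep 0, d = KZ.of r) ∨
            ∃ (r : KZ.IntegralRep 1) (p q : Polynomial ℝ), (∀ i, IsAlgebraic ℚ (p.coeff i)) ∧
              (∀ i, IsAlgebraic ℚ (q.coeff i)) ∧ (∀ x ∈ r.domain, q.eval (x 0) ≠ 0) ∧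
              Set.EqOn r.integrand (fun x => p.eval (x 0) / q.eval (x 0)) r.domain ∧ d = KZ.of r} ∪
          {d : KZ.FormalRep | ∃ (a b c : algebraicClosure ℚ ℝ)
              (P Q : MvPolynomial (Fin 2) (algebraicClosure ℚ ℝ)) (r : KZ.IntegralRep 1),
            (∀ x ∈ r.domain, 0 < (a : ℝ) * x 0 ^ 2 + (b : ℝ) * x 0 + c) ∧
            (∀ x ∈ r.domain,
              (MvPolynomial.aeval ![x 0, Real.sqrt ((a : ℝ) * x 0 ^ 2 + (b : ℝ) * x 0 + c)] Q : ℝ) ≠ 0) ∧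
            Set.EqOn r.integrand (fun x =>
              (MvPolynomial.aeval ![x 0, Real.sqrt ((a : ℝ) * x 0 ^ 2 + (b : ℝ) * x 0 + c)] P : ℝ) /
                MvPolynomial.aeval ![x 0, Real.sqrt ((a : ℝ) * x 0 ^ 2 + (b : ℝ) * x 0 + c)] Q) r.domain ∧
            d = KZ.of r} ∪
          {d : KZ.FormalRep | ∃ (n : ℕ) (a b c e : algebraicClosure ℚ ℝ)
              (P Q : MvPolynomial (Fin 2) (algebraicClosure ℚ ℝ)) (r : KZ.IntegralRep 1),
            0 < n ∧ (a : ℝ) * e - b * c ≠ 0 ∧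
            (∀ x ∈ r.domain, 0 < ((a : ℝ) * x 0 + b) / ((c : ℝ) * x 0 + e)) ∧
            (∀ x ∈ r.domain, (MvPolynomial.aeval
              ![x 0, (((a : ℝ) * x 0 + b) / ((c : ℝ) * x 0 + e)) ^ ((n : ℝ)⁻¹)] Q : ℝ) ≠ 0) ∧
            Set.EqOn r.integrand (fun x =>
              (MvPolynomial.aeval ![x 0, (((a : ℝ) * x 0 + b) / ((c : ℝ) * x 0 + e)) ^ ((n : ℝ)⁻¹)] P : ℝ) /
                MvPolynomial.aeval ![x 0, (((a : ℝ) * x 0 + b) / ((c : ℝ) * x 0 + e)) ^ ((n : ℝ)⁻¹)] Q)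
              r.domain ∧
            d = KZ.of r}),
      KZ.eval c = 0 → c ∈ KZ.relations ⊔ AddSubgroup.closure {d : KZ.FormalRep |
        ∃ (n : ℕ) (P Q : MvPolynomial (Fin (n + 1)) ℚ) (ε ϖ₀ : ℝ) (r : KZ.IntegralRep n), 0 < ε ∧
        (∃ c₀ : ℚ, c₀ ≠ 0 ∧ ∀ z : Fin n → ℝ,
          MvPolynomial.aeval (Fin.snoc z (0 : ℝ) : Fin (n + 1) → ℝ) Q = (c₀ : ℝ)) ∧
        (∀ (z : Fin n → ℝ) (ϖ : ℝ), (∀ i, z i ∈ Set.Icc (0 : ℝ) 1) → ϖ ∈ Set.Ioo 0 ε →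
          MvPolynomial.aeval (Fin.snoc z ϖ : Fin (n + 1) → ℝ) Q ≠ 0) ∧
        (∀ ϖ ∈ Set.Ioo (0 : ℝ) ε, ∫ z in Set.pi Set.univ (fun _ : Fin n => Set.Ioo (0 : ℝ) 1),
          MvPolynomial.aeval (Fin.snoc z ϖ : Fin (n + 1) → ℝ) P /
            MvPolynomial.aeval (Fin.snoc z ϖ : Fin (n + 1) → ℝ) Q = 0) ∧
        IsAlgebraic ℚ ϖ₀ ∧ ϖ₀ ∈ Set.Ioo 0 ε ∧
        r.domain = Set.pi Set.univ (fun _ : Fin n => Set.Ioo (0 : ℝ) 1) ∧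
        Set.EqOn r.integrand (fun z => MvPolynomial.aeval (Fin.snoc z ϖ₀ : Fin (n + 1) → ℝ) P /
          MvPolynomial.aeval (Fin.snoc z ϖ₀ : Fin (n + 1) → ℝ) Q) r.domain ∧
        d = KZ.of r} :=
  fun c hc h0 => AddSubgroup.mem_sup_left (genusZeroLowDimKernel c hc h0)

/-- **Conjecture 1 for a conic representation against a rational one**: a conic representation
`[σ, P(x,√q(x))/Q(x,√q(x))]` and an algebraic-coefficient rational representation of dimension one with the
same value are KZ-equivalent. [cite: KontsevichZagier2001, §1.2] -/
theorem kzPeriodConjecture_conic (a b c : algebraicClosure ℚ ℝ)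
    (P Q : MvPolynomial (Fin 2) (algebraicClosure ℚ ℝ)) (r r' : KZ.IntegralRep 1)
    (hpos : ∀ x ∈ r.domain, 0 < (a : ℝ) * x 0 ^ 2 + (b : ℝ) * x 0 + c)
    (hQ : ∀ x ∈ r.domain,
      (MvPolynomial.aeval ![x 0, Real.sqrt ((a : ℝ) * x 0 ^ 2 + (b : ℝ) * x 0 + c)] Q : ℝ) ≠ 0)
    (hint : Set.EqOn r.integrand (fun x =>
      (MvPolynomial.aeval ![x 0, Real.sqrt ((a : ℝ) * x 0 ^ 2 + (b : ℝ) * x 0 + c)] P : ℝ) /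
        MvPolynomial.aeval ![x 0, Real.sqrt ((a : ℝ) * x 0 ^ 2 + (b : ℝ) * x 0 + c)] Q) r.domain)
    (p q : Polynomial ℝ) (hp : ∀ i, IsAlgebraic ℚ (p.coeff i)) (hq : ∀ i, IsAlgebraic ℚ (q.coeff i))
    (hq0 : ∀ x ∈ r'.domain, q.eval (x 0) ≠ 0)
    (hpq : Set.EqOn r'.integrand (fun x => p.eval (x 0) / q.eval (x 0)) r'.domain)
    (hv : r.value = r'.value) : KZ.Equivalent r r' :=
  genusZeroLowDimKernel _
    (sub_mem (AddSubgroup.subset_closure (Or.inl (Or.inr ⟨a, b, c, P, Q, r, hpos, hQ, hint, rfl⟩)))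
      (AddSubgroup.subset_closure (Or.inl (Or.inl (Or.inr ⟨r', p, q, hp, hq, hq0, hpq, rfl⟩)))))
    (by rw [map_sub, KZ.eval_of, KZ.eval_of, hv, sub_self])

/-- **Conjecture 1 for two conic representations** (possibly different conics). [cite: KontsevichZagier2001, §1.2] -/
theorem kzPeriodConjecture_conic_conic {r r' : KZ.IntegralRep 1}
    (hr : KZ.of r ∈ {d : KZ.FormalRep | ∃ (a b c : algebraicClosure ℚ ℝ)
              (P Q : MvPolynomial (Fin 2) (algebraicClosure ℚ ℝ)) (r : KZ.IntegralRep 1),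
            (∀ x ∈ r.domain, 0 < (a : ℝ) * x 0 ^ 2 + (b : ℝ) * x 0 + c) ∧
            (∀ x ∈ r.domain,
              (MvPolynomial.aeval ![x 0, Real.sqrt ((a : ℝ) * x 0 ^ 2 + (b : ℝ) * x 0 + c)] Q : ℝ) ≠ 0) ∧
            Set.EqOn r.integrand (fun x =>
              (MvPolynomial.aeval ![x 0, Real.sqrt ((a : ℝ) * x 0 ^ 2 + (b : ℝ) * x 0 + c)] P : ℝ) /
                MvPolynomial.aeval ![x 0, Real.sqrt ((a : ℝ) * x 0 ^ 2 + (b : ℝ) * x 0 + c)] Q) r.domain ∧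
            d = KZ.of r})
    (hr' : KZ.of r' ∈ {d : KZ.FormalRep | ∃ (a b c : algebraicClosure ℚ ℝ)
              (P Q : MvPolynomial (Fin 2) (algebraicClosure ℚ ℝ)) (r : KZ.IntegralRep 1),
            (∀ x ∈ r.domain, 0 < (a : ℝ) * x 0 ^ 2 + (b : ℝ) * x 0 + c) ∧
            (∀ x ∈ r.domain,
              (MvPolynomial.aeval ![x 0, Real.sqrt ((a : ℝ) * x 0 ^ 2 + (b : ℝ) * x 0 + c)] Q : ℝ) ≠ 0) ∧
            Set.EqOn r.integrand (fun x =>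
              (MvPolynomial.aeval ![x 0, Real.sqrt ((a : ℝ) * x 0 ^ 2 + (b : ℝ) * x 0 + c)] P : ℝ) /
                MvPolynomial.aeval ![x 0, Real.sqrt ((a : ℝ) * x 0 ^ 2 + (b : ℝ) * x 0 + c)] Q) r.domain ∧
            d = KZ.of r})
    (hv : r.value = r'.value) : KZ.Equivalent r r' :=
  genusZeroLowDimKernel _
    (sub_mem (AddSubgroup.subset_closure (Or.inl (Or.inr hr))) (AddSubgroup.subset_closure (Or.inl (Or.inr hr'))))
    (by rw [map_sub, KZ.eval_of, KZ.eval_of, hv, sub_self])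

/-- **Conjecture 1 for a radical representation against a rational one**: `[σ, R(x, ⁿ√((ax+b)/(cx+e)))]`
and an algebraic-coefficient rational representation of dimension one with the same value are KZ-equivalent.
[cite: KontsevichZagier2001, §1.2] -/
theorem kzPeriodConjecture_root (n : ℕ) (a b c e : algebraicClosure ℚ ℝ)
    (P Q : MvPolynomial (Fin 2) (algebraicClosure ℚ ℝ)) (r r' : KZ.IntegralRep 1) (hn : 0 < n)
    (hdet : (a : ℝ) * e - b * c ≠ 0)
    (hpos : ∀ x ∈ r.domain, 0 < ((a : ℝ) * x 0 + b) / ((c : ℝ) * x 0 + e))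
    (hQ : ∀ x ∈ r.domain, (MvPolynomial.aeval
      ![x 0, (((a : ℝ) * x 0 + b) / ((c : ℝ) * x 0 + e)) ^ ((n : ℝ)⁻¹)] Q : ℝ) ≠ 0)
    (hint : Set.EqOn r.integrand (fun x =>
      (MvPolynomial.aeval ![x 0, (((a : ℝ) * x 0 + b) / ((c : ℝ) * x 0 + e)) ^ ((n : ℝ)⁻¹)] P : ℝ) /
        MvPolynomial.aeval ![x 0, (((a : ℝ) * x 0 + b) / ((c : ℝ) * x 0 + e)) ^ ((n : ℝ)⁻¹)] Q) r.domain)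
    (p q : Polynomial ℝ) (hp : ∀ i, IsAlgebraic ℚ (p.coeff i)) (hq : ∀ i, IsAlgebraic ℚ (q.coeff i))
    (hq0 : ∀ x ∈ r'.domain, q.eval (x 0) ≠ 0)
    (hpq : Set.EqOn r'.integrand (fun x => p.eval (x 0) / q.eval (x 0)) r'.domain)
    (hv : r.value = r'.value) : KZ.Equivalent r r' :=
  genusZeroLowDimKernel _
    (sub_mem (AddSubgroup.subset_closure (Or.inr ⟨n, a, b, c, e, P, Q, r, hn, hdet, hpos, hQ, hint, rfl⟩))
      (AddSubgroup.subset_closure (Or.inl (Or.inl (Or.inr ⟨r', p, q, hp, hq, hq0, hpq, rfl⟩)))))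
    (by rw [map_sub, KZ.eval_of, KZ.eval_of, hv, sub_self])

/-! ### Conic bands (areas) -/

namespace GenusZero

/-- **Reduction of the conic bands** (`tateLifting_bandArea`): `[B, 1] ≡ [τ, β − α]` by one Newton–Leibniz move, and
`β − α = (P_β Q_α − P_α Q_β)/(Q_α Q_β)` at `(x, √q(x))` is a conic integrand. [cite: KontsevichZagier2001, §1.2 rule (3)] -/
theorem conicBand_reduce :
    ∀ d ∈ {d : KZ.FormalRep | ∃ (a b c : algebraicClosure ℚ ℝ)
              (Pα Qα Pβ Qβ : MvPolynomial (Fin 2) (algebraicClosure ℚ ℝ)) (τ : Set (Fin 1 → ℝ))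
              (α β : (Fin 1 → ℝ) → ℝ) (r : KZ.IntegralRep 2),
            IsSemialgebraic ℚ τ ∧
            (∀ x ∈ τ, 0 < (a : ℝ) * x 0 ^ 2 + (b : ℝ) * x 0 + c) ∧
            (∀ x ∈ τ,
              (MvPolynomial.aeval ![x 0, Real.sqrt ((a : ℝ) * x 0 ^ 2 + (b : ℝ) * x 0 + c)] Qα : ℝ) ≠ 0) ∧
            (∀ x ∈ τ,
              (MvPolynomial.aeval ![x 0, Real.sqrt ((a : ℝ) * x 0 ^ 2 + (b : ℝ) * x 0 + c)] Qβ : ℝ) ≠ 0) ∧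
            (∀ x ∈ τ, α x =
              (MvPolynomial.aeval ![x 0, Real.sqrt ((a : ℝ) * x 0 ^ 2 + (b : ℝ) * x 0 + c)] Pα : ℝ) /
                MvPolynomial.aeval ![x 0, Real.sqrt ((a : ℝ) * x 0 ^ 2 + (b : ℝ) * x 0 + c)] Qα) ∧
            (∀ x ∈ τ, β x =
              (MvPolynomial.aeval ![x 0, Real.sqrt ((a : ℝ) * x 0 ^ 2 + (b : ℝ) * x 0 + c)] Pβ : ℝ) /
                MvPolynomial.aeval ![x 0, Real.sqrt ((a : ℝ) * x 0 ^ 2 + (b : ℝ) * x 0 + c)] Qβ) ∧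
            (∀ x ∈ τ, α x ≤ β x) ∧
            r.domain = {z | (Fin.init z : Fin 1 → ℝ) ∈ τ ∧ α (Fin.init z) ≤ z (Fin.last 1) ∧
              z (Fin.last 1) ≤ β (Fin.init z)} ∧
            Set.EqOn r.integrand (fun _ => 1) r.domain ∧ d = KZ.of r},
      ∃ ℓ ∈ AddSubgroup.closure
        ({d : KZ.FormalRep | (∃ r : KZ.IntegralRep 0, d = KZ.of r) ∨
            ∃ (r : KZ.IntegralRep 1) (p q : Polynomial ℝ), (∀ i, IsAlgebraic ℚ (p.coeff i)) ∧
              (∀ i, IsAlgebraic ℚ (q.coeff i)) ∧ (∀ x ∈ r.domain, q.eval (x 0) ≠ 0) ∧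
              Set.EqOn r.integrand (fun x => p.eval (x 0) / q.eval (x 0)) r.domain ∧ d = KZ.of r} ∪
          {d : KZ.FormalRep | ∃ (a b c : algebraicClosure ℚ ℝ)
              (P Q : MvPolynomial (Fin 2) (algebraicClosure ℚ ℝ)) (r : KZ.IntegralRep 1),
            (∀ x ∈ r.domain, 0 < (a : ℝ) * x 0 ^ 2 + (b : ℝ) * x 0 + c) ∧
            (∀ x ∈ r.domain,
              (MvPolynomial.aeval ![x 0, Real.sqrt ((a : ℝ) * x 0 ^ 2 + (b : ℝ) * x 0 + c)] Q : ℝ) ≠ 0) ∧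
            Set.EqOn r.integrand (fun x =>
              (MvPolynomial.aeval ![x 0, Real.sqrt ((a : ℝ) * x 0 ^ 2 + (b : ℝ) * x 0 + c)] P : ℝ) /
                MvPolynomial.aeval ![x 0, Real.sqrt ((a : ℝ) * x 0 ^ 2 + (b : ℝ) * x 0 + c)] Q) r.domain ∧
            d = KZ.of r} ∪
          {d : KZ.FormalRep | ∃ (n : ℕ) (a b c e : algebraicClosure ℚ ℝ)
              (P Q : MvPolynomial (Fin 2) (algebraicClosure ℚ ℝ)) (r : KZ.IntegralRep 1),
            0 < n ∧ (a : ℝ) * e - b * c ≠ 0 ∧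
            (∀ x ∈ r.domain, 0 < ((a : ℝ) * x 0 + b) / ((c : ℝ) * x 0 + e)) ∧
            (∀ x ∈ r.domain, (MvPolynomial.aeval
              ![x 0, (((a : ℝ) * x 0 + b) / ((c : ℝ) * x 0 + e)) ^ ((n : ℝ)⁻¹)] Q : ℝ) ≠ 0) ∧
            Set.EqOn r.integrand (fun x =>
              (MvPolynomial.aeval ![x 0, (((a : ℝ) * x 0 + b) / ((c : ℝ) * x 0 + e)) ^ ((n : ℝ)⁻¹)] P : ℝ) /
                MvPolynomial.aeval ![x 0, (((a : ℝ) * x 0 + b) / ((c : ℝ) * x 0 + e)) ^ ((n : ℝ)⁻¹)] Q)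
              r.domain ∧
            d = KZ.of r}),
      d - ℓ ∈ KZ.relations := by
  rintro d ⟨a, b, c, Pα, Qα, Pβ, Qβ, τ, α, β, r, hτ, hpos, hQα, hQβ, hα, hβ, hle, hdom, hint, rfl⟩
  have hαs : IsSemialgebraicFunOn ℚ τ α := isSemialgebraicFunOn_arc hτ a b c Pα Qα hQα hα
  have hβs : IsSemialgebraicFunOn ℚ τ β := isSemialgebraicFunOn_arc hτ a b c Pβ Qβ hQβ hβ
  obtain ⟨r', hdom', hint', hrel⟩ := tateLifting_bandArea 1 r τ α β hτ hαs hβs hle hdom hint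
  refine ⟨KZ.of r', AddSubgroup.subset_closure (Or.inl (Or.inr
    ⟨a, b, c, Pβ * Qα - Pα * Qβ, Qα * Qβ, r', ?_, ?_, ?_, rfl⟩)), hrel⟩
  · rw [hdom']; exact hpos
  · rw [hdom']
    intro x hx
    rw [map_mul]
    exact mul_ne_zero (hQα x hx) (hQβ x hx)
  · rw [hdom', hint']
    intro x hx
    simp only [map_sub, map_mul]
    rw [hβ x hx, hα x hx, div_sub_div _ _ (hQβ x hx) (hQα x hx)]
    ring

end GenusZero

/-- **THE GENUS-ZERO SECTOR WITH CONIC BANDS (kernel form).** Conjecture 1 holds on the subgroup of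
`KZ.FormalRep` generated by the genus-zero generators and the area representations `[B, 1]` of conic bands
`B = {(x, y) | x ∈ τ, A(x, √q(x)) ≤ y ≤ B(x, √q(x))}` (`A, B ∈ K(X, Y)`, `q = ax² + bx + c > 0` on the
`ℚ`-semialgebraic base `τ`). [cite: KontsevichZagier2001, §1.2] -/
theorem conicBandKernel :
    ∀ c ∈ AddSubgroup.closure
        (({d : KZ.FormalRep | (∃ r : KZ.IntegralRep 0, d = KZ.of r) ∨
            ∃ (r : KZ.IntegralRep 1) (p q : Polynomial ℝ), (∀ i, IsAlgebraic ℚ (p.coeff i)) ∧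
              (∀ i, IsAlgebraic ℚ (q.coeff i)) ∧ (∀ x ∈ r.domain, q.eval (x 0) ≠ 0) ∧
              Set.EqOn r.integrand (fun x => p.eval (x 0) / q.eval (x 0)) r.domain ∧ d = KZ.of r} ∪
          {d : KZ.FormalRep | ∃ (a b c : algebraicClosure ℚ ℝ)
              (P Q : MvPolynomial (Fin 2) (algebraicClosure ℚ ℝ)) (r : KZ.IntegralRep 1),
            (∀ x ∈ r.domain, 0 < (a : ℝ) * x 0 ^ 2 + (b : ℝ) * x 0 + c) ∧
            (∀ x ∈ r.domain,
              (MvPolynomial.aeval ![x 0, Real.sqrt ((a : ℝ) * x 0 ^ 2 + (b : ℝ) * x 0 + c)] Q : ℝ) ≠ 0) ∧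
            Set.EqOn r.integrand (fun x =>
              (MvPolynomial.aeval ![x 0, Real.sqrt ((a : ℝ) * x 0 ^ 2 + (b : ℝ) * x 0 + c)] P : ℝ) /
                MvPolynomial.aeval ![x 0, Real.sqrt ((a : ℝ) * x 0 ^ 2 + (b : ℝ) * x 0 + c)] Q) r.domain ∧
            d = KZ.of r} ∪
          {d : KZ.FormalRep | ∃ (n : ℕ) (a b c e : algebraicClosure ℚ ℝ)
              (P Q : MvPolynomial (Fin 2) (algebraicClosure ℚ ℝ)) (r : KZ.IntegralRep 1),
            0 < n ∧ (a : ℝ) * e - b * c ≠ 0 ∧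
            (∀ x ∈ r.domain, 0 < ((a : ℝ) * x 0 + b) / ((c : ℝ) * x 0 + e)) ∧
            (∀ x ∈ r.domain, (MvPolynomial.aeval
              ![x 0, (((a : ℝ) * x 0 + b) / ((c : ℝ) * x 0 + e)) ^ ((n : ℝ)⁻¹)] Q : ℝ) ≠ 0) ∧
            Set.EqOn r.integrand (fun x =>
              (MvPolynomial.aeval ![x 0, (((a : ℝ) * x 0 + b) / ((c : ℝ) * x 0 + e)) ^ ((n : ℝ)⁻¹)] P : ℝ) /
                MvPolynomial.aeval ![x 0, (((a : ℝ) * x 0 + b) / ((c : ℝ) * x 0 + e)) ^ ((n : ℝ)⁻¹)] Q)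
              r.domain ∧
            d = KZ.of r}) ∪
          {d : KZ.FormalRep | ∃ (a b c : algebraicClosure ℚ ℝ)
              (Pα Qα Pβ Qβ : MvPolynomial (Fin 2) (algebraicClosure ℚ ℝ)) (τ : Set (Fin 1 → ℝ))
              (α β : (Fin 1 → ℝ) → ℝ) (r : KZ.IntegralRep 2),
            IsSemialgebraic ℚ τ ∧
            (∀ x ∈ τ, 0 < (a : ℝ) * x 0 ^ 2 + (b : ℝ) * x 0 + c) ∧
            (∀ x ∈ τ,
              (MvPolynomial.aeval ![x 0, Real.sqrt ((a : ℝ) * x 0 ^ 2 + (b : ℝ) * x 0 + c)] Qα : ℝ) ≠ 0) ∧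
            (∀ x ∈ τ,
              (MvPolynomial.aeval ![x 0, Real.sqrt ((a : ℝ) * x 0 ^ 2 + (b : ℝ) * x 0 + c)] Qβ : ℝ) ≠ 0) ∧
            (∀ x ∈ τ, α x =
              (MvPolynomial.aeval ![x 0, Real.sqrt ((a : ℝ) * x 0 ^ 2 + (b : ℝ) * x 0 + c)] Pα : ℝ) /
                MvPolynomial.aeval ![x 0, Real.sqrt ((a : ℝ) * x 0 ^ 2 + (b : ℝ) * x 0 + c)] Qα) ∧
            (∀ x ∈ τ, β x =
              (MvPolynomial.aeval ![x 0, Real.sqrt ((a : ℝ) * x 0 ^ 2 + (b : ℝ) * x 0 + c)] Pβ : ℝ) /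
                MvPolynomial.aeval ![x 0, Real.sqrt ((a : ℝ) * x 0 ^ 2 + (b : ℝ) * x 0 + c)] Qβ) ∧
            (∀ x ∈ τ, α x ≤ β x) ∧
            r.domain = {z | (Fin.init z : Fin 1 → ℝ) ∈ τ ∧ α (Fin.init z) ≤ z (Fin.last 1) ∧
              z (Fin.last 1) ≤ β (Fin.init z)} ∧
            Set.EqOn r.integrand (fun _ => 1) r.domain ∧ d = KZ.of r}),
      KZ.eval c = 0 → c ∈ KZ.relations := by
  refine GenusZero.kernel_of_reduce (fun d hd => ?_) genusZeroLowDimKernel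
  rcases hd with hd | hd
  · exact ⟨d, AddSubgroup.subset_closure hd, by rw [sub_self]; exact KZ.relations.zero_mem⟩
  · exact GenusZero.conicBand_reduce d hd

/-- **Two conic bands over `ℚ̄ ∩ ℝ` with the same area are KZ-equivalent** (scissors congruence for degree-two
plane regions in the Kontsevich–Zagier calculus). [cite: KontsevichZagier2001, §1.2] -/
theorem kzPeriodConjecture_conicBand {r r' : KZ.IntegralRep 2}
    (hr : KZ.of r ∈ {d : KZ.FormalRep | ∃ (a b c : algebraicClosure ℚ ℝ)
              (Pα Qα Pβ Qβ : MvPolynomial (Fin 2) (algebraicClosure ℚ ℝ)) (τ : Set (Fin 1 → ℝ))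
              (α β : (Fin 1 → ℝ) → ℝ) (r : KZ.IntegralRep 2),
            IsSemialgebraic ℚ τ ∧
            (∀ x ∈ τ, 0 < (a : ℝ) * x 0 ^ 2 + (b : ℝ) * x 0 + c) ∧
            (∀ x ∈ τ,
              (MvPolynomial.aeval ![x 0, Real.sqrt ((a : ℝ) * x 0 ^ 2 + (b : ℝ) * x 0 + c)] Qα : ℝ) ≠ 0) ∧
            (∀ x ∈ τ,
              (MvPolynomial.aeval ![x 0, Real.sqrt ((a : ℝ) * x 0 ^ 2 + (b : ℝ) * x 0 + c)] Qβ : ℝ) ≠ 0) ∧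
            (∀ x ∈ τ, α x =
              (MvPolynomial.aeval ![x 0, Real.sqrt ((a : ℝ) * x 0 ^ 2 + (b : ℝ) * x 0 + c)] Pα : ℝ) /
                MvPolynomial.aeval ![x 0, Real.sqrt ((a : ℝ) * x 0 ^ 2 + (b : ℝ) * x 0 + c)] Qα) ∧
            (∀ x ∈ τ, β x =
              (MvPolynomial.aeval ![x 0, Real.sqrt ((a : ℝ) * x 0 ^ 2 + (b : ℝ) * x 0 + c)] Pβ : ℝ) /
                MvPolynomial.aeval ![x 0, Real.sqrt ((a : ℝ) * x 0 ^ 2 + (b : ℝ) * x 0 + c)] Qβ) ∧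
            (∀ x ∈ τ, α x ≤ β x) ∧
            r.domain = {z | (Fin.init z : Fin 1 → ℝ) ∈ τ ∧ α (Fin.init z) ≤ z (Fin.last 1) ∧
              z (Fin.last 1) ≤ β (Fin.init z)} ∧
            Set.EqOn r.integrand (fun _ => 1) r.domain ∧ d = KZ.of r})
    (hr' : KZ.of r' ∈ {d : KZ.FormalRep | ∃ (a b c : algebraicClosure ℚ ℝ)
              (Pα Qα Pβ Qβ : MvPolynomial (Fin 2) (algebraicClosure ℚ ℝ)) (τ : Set (Fin 1 → ℝ))
              (α β : (Fin 1 → ℝ) → ℝ) (r : KZ.IntegralRep 2),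
            IsSemialgebraic ℚ τ ∧
            (∀ x ∈ τ, 0 < (a : ℝ) * x 0 ^ 2 + (b : ℝ) * x 0 + c) ∧
            (∀ x ∈ τ,
              (MvPolynomial.aeval ![x 0, Real.sqrt ((a : ℝ) * x 0 ^ 2 + (b : ℝ) * x 0 + c)] Qα : ℝ) ≠ 0) ∧
            (∀ x ∈ τ,
              (MvPolynomial.aeval ![x 0, Real.sqrt ((a : ℝ) * x 0 ^ 2 + (b : ℝ) * x 0 + c)] Qβ : ℝ) ≠ 0) ∧
            (∀ x ∈ τ, α x =
              (MvPolynomial.aeval ![x 0, Real.sqrt ((a : ℝ) * x 0 ^ 2 + (b : ℝ) * x 0 + c)] Pα : ℝ) /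
                MvPolynomial.aeval ![x 0, Real.sqrt ((a : ℝ) * x 0 ^ 2 + (b : ℝ) * x 0 + c)] Qα) ∧
            (∀ x ∈ τ, β x =
              (MvPolynomial.aeval ![x 0, Real.sqrt ((a : ℝ) * x 0 ^ 2 + (b : ℝ) * x 0 + c)] Pβ : ℝ) /
                MvPolynomial.aeval ![x 0, Real.sqrt ((a : ℝ) * x 0 ^ 2 + (b : ℝ) * x 0 + c)] Qβ) ∧
            (∀ x ∈ τ, α x ≤ β x) ∧
            r.domain = {z | (Fin.init z : Fin 1 → ℝ) ∈ τ ∧ α (Fin.init z) ≤ z (Fin.last 1) ∧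
              z (Fin.last 1) ≤ β (Fin.init z)} ∧
            Set.EqOn r.integrand (fun _ => 1) r.domain ∧ d = KZ.of r})
    (hv : r.value = r'.value) : KZ.Equivalent r r' :=
  conicBandKernel _
    (sub_mem (AddSubgroup.subset_closure (Or.inr hr)) (AddSubgroup.subset_closure (Or.inr hr')))
    (by rw [map_sub, KZ.eval_of, KZ.eval_of, hv, sub_self])

/-- **A conic band against a genus-zero one-form** with the same value: KZ-equivalent (e.g. the half-disc band
`{−1 ≤ x ≤ 1, 0 ≤ y ≤ √(1−x²)}` against `[(0,1), 2/(1+x²)]`). [cite: KontsevichZagier2001, §1.2] -/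
theorem kzPeriodConjecture_conicBand_genusZero {r : KZ.IntegralRep 2} {r' : KZ.IntegralRep 1}
    (hr : KZ.of r ∈ {d : KZ.FormalRep | ∃ (a b c : algebraicClosure ℚ ℝ)
              (Pα Qα Pβ Qβ : MvPolynomial (Fin 2) (algebraicClosure ℚ ℝ)) (τ : Set (Fin 1 → ℝ))
              (α β : (Fin 1 → ℝ) → ℝ) (r : KZ.IntegralRep 2),
            IsSemialgebraic ℚ τ ∧
            (∀ x ∈ τ, 0 < (a : ℝ) * x 0 ^ 2 + (b : ℝ) * x 0 + c) ∧
            (∀ x ∈ τ,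
              (MvPolynomial.aeval ![x 0, Real.sqrt ((a : ℝ) * x 0 ^ 2 + (b : ℝ) * x 0 + c)] Qα : ℝ) ≠ 0) ∧
            (∀ x ∈ τ,
              (MvPolynomial.aeval ![x 0, Real.sqrt ((a : ℝ) * x 0 ^ 2 + (b : ℝ) * x 0 + c)] Qβ : ℝ) ≠ 0) ∧
            (∀ x ∈ τ, α x =
              (MvPolynomial.aeval ![x 0, Real.sqrt ((a : ℝ) * x 0 ^ 2 + (b : ℝ) * x 0 + c)] Pα : ℝ) /
                MvPolynomial.aeval ![x 0, Real.sqrt ((a : ℝ) * x 0 ^ 2 + (b : ℝ) * x 0 + c)] Qα) ∧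
            (∀ x ∈ τ, β x =
              (MvPolynomial.aeval ![x 0, Real.sqrt ((a : ℝ) * x 0 ^ 2 + (b : ℝ) * x 0 + c)] Pβ : ℝ) /
                MvPolynomial.aeval ![x 0, Real.sqrt ((a : ℝ) * x 0 ^ 2 + (b : ℝ) * x 0 + c)] Qβ) ∧
            (∀ x ∈ τ, α x ≤ β x) ∧
            r.domain = {z | (Fin.init z : Fin 1 → ℝ) ∈ τ ∧ α (Fin.init z) ≤ z (Fin.last 1) ∧
              z (Fin.last 1) ≤ β (Fin.init z)} ∧
            Set.EqOn r.integrand (fun _ => 1) r.domain ∧ d = KZ.of r})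
    (hr' : KZ.of r' ∈ ({d : KZ.FormalRep | (∃ r : KZ.IntegralRep 0, d = KZ.of r) ∨
            ∃ (r : KZ.IntegralRep 1) (p q : Polynomial ℝ), (∀ i, IsAlgebraic ℚ (p.coeff i)) ∧
              (∀ i, IsAlgebraic ℚ (q.coeff i)) ∧ (∀ x ∈ r.domain, q.eval (x 0) ≠ 0) ∧
              Set.EqOn r.integrand (fun x => p.eval (x 0) / q.eval (x 0)) r.domain ∧ d = KZ.of r} ∪
          {d : KZ.FormalRep | ∃ (a b c : algebraicClosure ℚ ℝ)
              (P Q : MvPolynomial (Fin 2) (algebraicClosure ℚ ℝ)) (r : KZ.IntegralRep 1),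
            (∀ x ∈ r.domain, 0 < (a : ℝ) * x 0 ^ 2 + (b : ℝ) * x 0 + c) ∧
            (∀ x ∈ r.domain,
              (MvPolynomial.aeval ![x 0, Real.sqrt ((a : ℝ) * x 0 ^ 2 + (b : ℝ) * x 0 + c)] Q : ℝ) ≠ 0) ∧
            Set.EqOn r.integrand (fun x =>
              (MvPolynomial.aeval ![x 0, Real.sqrt ((a : ℝ) * x 0 ^ 2 + (b : ℝ) * x 0 + c)] P : ℝ) /
                MvPolynomial.aeval ![x 0, Real.sqrt ((a : ℝ) * x 0 ^ 2 + (b : ℝ) * x 0 + c)] Q) r.domain ∧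
            d = KZ.of r} ∪
          {d : KZ.FormalRep | ∃ (n : ℕ) (a b c e : algebraicClosure ℚ ℝ)
              (P Q : MvPolynomial (Fin 2) (algebraicClosure ℚ ℝ)) (r : KZ.IntegralRep 1),
            0 < n ∧ (a : ℝ) * e - b * c ≠ 0 ∧
            (∀ x ∈ r.domain, 0 < ((a : ℝ) * x 0 + b) / ((c : ℝ) * x 0 + e)) ∧
            (∀ x ∈ r.domain, (MvPolynomial.aeval
              ![x 0, (((a : ℝ) * x 0 + b) / ((c : ℝ) * x 0 + e)) ^ ((n : ℝ)⁻¹)] Q : ℝ) ≠ 0) ∧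
            Set.EqOn r.integrand (fun x =>
              (MvPolynomial.aeval ![x 0, (((a : ℝ) * x 0 + b) / ((c : ℝ) * x 0 + e)) ^ ((n : ℝ)⁻¹)] P : ℝ) /
                MvPolynomial.aeval ![x 0, (((a : ℝ) * x 0 + b) / ((c : ℝ) * x 0 + e)) ^ ((n : ℝ)⁻¹)] Q)
              r.domain ∧
            d = KZ.of r}))
    (hv : r.value = r'.value) : KZ.Equivalent r r' :=
  conicBandKernel _
    (sub_mem (AddSubgroup.subset_closure (Or.inr hr)) (AddSubgroup.subset_closure (Or.inl hr')))
    (by rw [map_sub, KZ.eval_of, KZ.eval_of, hv, sub_self])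

end Summit.KontsevichZagierPeriods.InverseLandau

end
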